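import Literature.NumberTheory.Rogawski1990.SemilocalCharactersLinIndep     -- ★ `ArchTestKc`
import Literature.NumberTheory.Automorphic.ArchTestFunctionConvolution      -- ★ `archExtZero`, `IsArchTestFunction.contDiff_archExtZero`, `mulConv` (via `AutomorphicQuotientKernelConvolution`)
import Literature.NumberTheory.Automorphic.ArchTestFunctionSpace            -- ★ `IsArchTestFunction.isArchSmooth_of_contDiff_slice`
import Literature.NumberTheory.Automorphic.ArchGardingWhittaker             -- ★ `IsArchTestFunction`
import Literature.NumberTheory.Automorphic.UnitaryGroupArchTopology         -- ★ instances: `arch` locally compact, second countable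
import Literature.Analysis.Calculus.SmoothKernelIntegral                    -- ★ `contDiff_integral_kernel_mul`
import Literature.NumberTheory.Automorphic.HarishChandraConvolutionGL         -- ★ `locallyCompactSpace_glInf`, `secondCountableTopology_glInf`
import HarnessLib

/-!
# The archimedean test space `ArchTestKc` is closed under convolution (Labesse–Langlands 1979, Lemma 6.1 p. 768 «`B` … closed under the obvious
# convolution product»; Rogawski 1990, §14.2 p. 233) — the convolution half of sub-goal (β)(a) of the T1 arch line

Topic `NumberTheory/Rogawski1990`; namespace `Literature.NumberTheory.Rogawski1990` (home of ★ `ArchTestKc`).  KERNEL ONLY: theorems, 0 definitions, 0 named facts,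
0 `sorry`.  Cell `hodgecm-mathlib`, floor 0, programme P3, typer topic T1 (statement tree of the letter (L2-SA) ★ `SemilocalCharactersLinIndep`, row #85); the
ARCH line `Lines-draft/T1a_ArchCharactersLinIndep.lean` (typ-T1a (g0)) §0 sub-goal `ArchTestKcPackage` (a) asks that ★ `ArchTestKc` be closed under ★ `mulStar` (★
p826869 `ArchTestKc.mulStar`, A-p01 (g17)) AND under ★ `mulConv νinf` — this file: **`ArchTestKc.mulConv`**.  Seat F0P3-p01 (g9) (A-p01 15:16:26Z hand-over of the
convolution half).

THE MATHEMATICS.  `G′_∞ = U(H)(L⁺ ⊗ ℝ) ≤ GL₃(L ⊗ ℝ)` (★ `UnitaryGroup.arch`, a closed subgroup), `νinf` a Haar measure on `G′_∞`, `φ, ψ ∈ ArchTestKc` (each the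
restriction to `G′_∞` of a smooth compactly supported `φ', ψ'` on `GL₃(L ⊗ ℝ)`, bi-invariant under the compact factor `K_c`).  Then
`(φ ⋆ ψ)(g) = ∫_{G′_∞} φ(u) ψ(u⁻¹ g) dνinf(u)` (★ `mulConv`) is again in `ArchTestKc`:
* §1 the SMOOTH MODEL on `GL₃(L ⊗ ℝ)` is `Ψ(g') = ∫_{G′_∞} φ(u) ψ'(u⁻¹ g') dνinf(u)` — continuous (parametric integral over the compact `supp φ`), compactly
  supported (in `supp φ · supp ψ'`), and ARCH-SMOOTH: its right exponential slices `M ↦ Ψ(g' e^M) = ∫ ψ'₀(u⁻¹ g' e^M) φ(u) dνinf(u)` (`ψ'₀` = ★ `archExtZero ψ'`,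
  smooth on all matrices) are `C^∞` by differentiation under the integral sign (★ `Literature.Analysis.Calculus.contDiff_integral_kernel_mul`, the weight `φ`
  integrable, `u ↦ u⁻¹` bounded on `supp φ`) and ★ `IsArchTestFunction.isArchSmooth_of_contDiff_slice` — the pattern of ★ `IsArchTestFunction.isArchSmooth_measConv`
  with a complex weight;
* §2 `Ψ ∘ incl = φ ⋆ ψ`; RIGHT `K_c`-invariance from that of `ψ` (`u⁻¹ (a k) = (u⁻¹ a) k`); LEFT `K_c`-invariance from that of `φ` after the substitution
  `u ↦ k u` (left invariance of `νinf`, Mathlib `integral_mul_left_eq_self`).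
[LabesseLanglands1979, Lemma 6.1 p. 768]; [Rogawski1990, §14.2 p. 233 («`f′ = ⊗ f′_v ∈ C_c^∞(G′(𝔸))`»)]; [DeitmarEchterhoff2014, Lemma 1.6.3].

## References
* J.-P. Labesse, R. P. Langlands, *L-indistinguishability for SL(2)*, Canad. J. Math. 31 (1979), Lemma 6.1, p. 768 [LabesseLanglands1979].
* J. D. Rogawski, *Automorphic Representations of Unitary Groups in Three Variables* (1990), §14.2 p. 233 [Rogawski1990].
* A. Deitmar, S. Echterhoff, *Principles of Harmonic Analysis*, 2nd ed. (2014), Lemma 1.6.3 [DeitmarEchterhoff2014].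
-/

set_option autoImplicit false

noncomputable section

open NumberField NumberField.mixedEmbedding IsDedekindDomain MeasureTheory Measure Set Filter Topology
-- `Classical`: the place subtypes indexing `mixedSpace L` are `Fintype` classically (`NormedCommRing (mixedSpace L)`); `Matrix.Norms.Operator`: the normed ring
-- `M₃(L ⊗ ℝ)` (topology instances on `GL₃(L ⊗ ℝ)`), as in ★ `ArchMeasureConvTestFunction`; `ContDiff`: the exponent `∞`.
open scoped Matrix ComplexConjugate Classical ContDiff Matrix.Norms.Operator Topology

namespace Literature.NumberTheory.Rogawski1990

open Literature.NumberTheory.Automorphic Literature.NumberTheory.Automorphic.UnitaryGroup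
open Literature.NumberTheory.Automorphic.UnitaryGroup.CotangentForms

variable (L : Type) [Field L] [NumberField L] [IsCMField L] (ι : L →+* ℂ) (H : Matrix (Fin 3) (Fin 3) L) (T : GL (Fin 3) ℂ)
  (hT : (T : Matrix (Fin 3) (Fin 3) ℂ)ᴴ * H.map ι * (T : Matrix (Fin 3) (Fin 3) ℂ) = Literature.Geometry.ComplexHyperbolic.BallModel.J)

/-! ## §1 The smooth model `Ψ(g') = ∫_{G′_∞} φ(u) ψ'(u⁻¹ g') dνinf(u)` on `GL₃(L ⊗ ℝ)` -/

section Model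

variable {L H}
variable (νinf : @Measure (UnitaryGroup.arch (↥(maximalRealSubfield L)) L (IsCMField.complexConj L) 3 H) (borel _))
  {φ : UnitaryGroup.arch (↥(maximalRealSubfield L)) L (IsCMField.complexConj L) 3 H → ℂ}
  {ψ' : GL (Fin 3) (mixedSpace L) → ℂ}

omit ι T hT in
/-- **The model is continuous**: `g' ↦ ∫ φ(u) ψ'(u⁻¹ g') dνinf(u)` is a parametric integral of a jointly continuous integrand over the compact `supp φ`
(Mathlib `continuous_parametric_integral_of_continuous`). [cite: DeitmarEchterhoff2014, Lemma 1.6.3] -/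
theorem continuous_archConvModel (hφc : Continuous φ) (hφs : HasCompactSupport φ) (hψ'c : Continuous ψ') :
    letI : MeasurableSpace (UnitaryGroup.arch (↥(maximalRealSubfield L)) L (IsCMField.complexConj L) 3 H) := borel _
    ∀ (_ : IsFiniteMeasureOnCompacts νinf),
    Continuous fun g' : GL (Fin 3) (mixedSpace L) =>
      ∫ u, φ u * ψ' ((u⁻¹ : UnitaryGroup.arch (↥(maximalRealSubfield L)) L (IsCMField.complexConj L) 3 H) * g') ∂νinf := by
  letI : MeasurableSpace (UnitaryGroup.arch (↥(maximalRealSubfield L)) L (IsCMField.complexConj L) 3 H) := borel _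
  haveI : BorelSpace (UnitaryGroup.arch (↥(maximalRealSubfield L)) L (IsCMField.complexConj L) 3 H) := ⟨rfl⟩
  intro hfin
  haveI := hfin
  -- `GL₃(L ⊗ ℝ)` is locally compact and second countable (hence first countable), ★ `HarishChandraConvolutionGL`
  haveI : LocallyCompactSpace (GL (Fin 3) (mixedSpace L)) := locallyCompactSpace_glInf 3 L
  haveI : SecondCountableTopology (GL (Fin 3) (mixedSpace L)) := secondCountableTopology_glInf 3 L
  have hFc : Continuous (Function.uncurry fun (g' : GL (Fin 3) (mixedSpace L))
      (u : UnitaryGroup.arch (↥(maximalRealSubfield L)) L (IsCMField.complexConj L) 3 H) =>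
        φ u * ψ' ((u⁻¹ : UnitaryGroup.arch (↥(maximalRealSubfield L)) L (IsCMField.complexConj L) 3 H) * g')) := by
    have h1 : (Function.uncurry fun (g' : GL (Fin 3) (mixedSpace L))
        (u : UnitaryGroup.arch (↥(maximalRealSubfield L)) L (IsCMField.complexConj L) 3 H) =>
          φ u * ψ' ((u⁻¹ : UnitaryGroup.arch (↥(maximalRealSubfield L)) L (IsCMField.complexConj L) 3 H) * g')) =
        fun q => φ q.2 * ψ' (((q.2⁻¹ : UnitaryGroup.arch (↥(maximalRealSubfield L)) L (IsCMField.complexConj L) 3 H) :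
          GL (Fin 3) (mixedSpace L)) * q.1) := by
      funext q; rfl
    rw [h1]
    exact (hφc.comp continuous_snd).mul (hψ'c.comp ((continuous_subtype_val.comp (continuous_snd.inv)).mul continuous_fst))
  have h := continuous_parametric_integral_of_continuous (μ := νinf) hFc hφs.isCompact
  have heq : (fun g' : GL (Fin 3) (mixedSpace L) =>
      ∫ u, φ u * ψ' ((u⁻¹ : UnitaryGroup.arch (↥(maximalRealSubfield L)) L (IsCMField.complexConj L) 3 H) * g') ∂νinf) =
      fun g' => ∫ u in tsupport φ, φ u * ψ' ((u⁻¹ : UnitaryGroup.arch (↥(maximalRealSubfield L)) L (IsCMField.complexConj L) 3 H) * g') ∂νinf := by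
    funext g'
    rw [setIntegral_eq_integral_of_forall_compl_eq_zero]
    intro u hu
    rw [image_eq_zero_of_notMem_tsupport hu, zero_mul]
  rw [heq]
  exact h

omit ι T hT in
/-- **The model has compact support** (inside `supp φ · supp ψ'`, with `supp φ` read in `GL₃(L ⊗ ℝ)`). [cite: DeitmarEchterhoff2014, Lemma 1.6.3] -/
theorem hasCompactSupport_archConvModel (hφs : HasCompactSupport φ) (hψ's : HasCompactSupport ψ') :
    HasCompactSupport fun g' : GL (Fin 3) (mixedSpace L) =>
      ∫ u, φ u * ψ' ((u⁻¹ : UnitaryGroup.arch (↥(maximalRealSubfield L)) L (IsCMField.complexConj L) 3 H) * g') ∂νinf := by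
  refine HasCompactSupport.intro ((hφs.isCompact.image continuous_subtype_val).mul hψ's.isCompact) fun g' hg' => ?_
  refine integral_eq_zero_of_ae (Eventually.of_forall fun u => ?_)
  by_cases hu : u ∈ tsupport φ
  · have hu2 : ((u⁻¹ : UnitaryGroup.arch (↥(maximalRealSubfield L)) L (IsCMField.complexConj L) 3 H) : GL (Fin 3) (mixedSpace L)) * g' ∉
        tsupport ψ' := by
      intro h2
      refine hg' ⟨(u : GL (Fin 3) (mixedSpace L)), ⟨u, hu, rfl⟩, _, h2, ?_⟩
      simp only [Subgroup.coe_inv, mul_inv_cancel_left]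
    change φ u * ψ' _ = 0
    rw [image_eq_zero_of_notMem_tsupport hu2, mul_zero]
  · change φ u * ψ' _ = 0
    rw [image_eq_zero_of_notMem_tsupport hu, zero_mul]

omit ι T hT in
/-- **The model is ARCH-SMOOTH**: its right exponential slices `M ↦ ∫ ψ'₀(u⁻¹ g' e^M) φ(u) dνinf(u)` (`ψ'₀ = archExtZero ψ'`) are `C^∞` on `M₃(L ⊗ ℝ)` by
differentiation under the integral sign (★ `contDiff_integral_kernel_mul`: smooth kernel `(M, m) ↦ ψ'₀(m g' e^M)`, bounded `m(u) = u⁻¹` on the compact `supp φ`,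
integrable weight `φ`), whence ★ `IsArchTestFunction.isArchSmooth_of_contDiff_slice`. [cite: DeitmarEchterhoff2014, Lemma 1.6.3] -/
theorem isArchSmooth_archConvModel (hφc : Continuous φ) (hφs : HasCompactSupport φ) (hψ' : IsArchTestFunction 3 L ψ') :
    letI : MeasurableSpace (UnitaryGroup.arch (↥(maximalRealSubfield L)) L (IsCMField.complexConj L) 3 H) := borel _
    ∀ (_ : IsFiniteMeasureOnCompacts νinf),
    IsArchSmooth (archGroupGL 3 L).carrier.subtype fun g' : GL (Fin 3) (mixedSpace L) =>
      ∫ u, φ u * ψ' ((u⁻¹ : UnitaryGroup.arch (↥(maximalRealSubfield L)) L (IsCMField.complexConj L) 3 H) * g') ∂νinf := by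
  letI : MeasurableSpace (UnitaryGroup.arch (↥(maximalRealSubfield L)) L (IsCMField.complexConj L) 3 H) := borel _
  haveI : BorelSpace (UnitaryGroup.arch (↥(maximalRealSubfield L)) L (IsCMField.complexConj L) 3 H) := ⟨rfl⟩
  intro hfin
  haveI := hfin
  refine IsArchTestFunction.isArchSmooth_of_contDiff_slice fun g' => ?_
  -- the smooth kernel `A(M, m) = ψ'₀(m g' e^M)`
  set A : (Matrix (Fin 3) (Fin 3) (mixedSpace L)) × (Matrix (Fin 3) (Fin 3) (mixedSpace L)) → ℂ :=
    fun p => archExtZero ψ' (p.2 * (g' : Matrix (Fin 3) (Fin 3) (mixedSpace L)) * NormedSpace.exp p.1) with hA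
  have hexp : ContDiff ℝ ∞ (NormedSpace.exp : Matrix (Fin 3) (Fin 3) (mixedSpace L) → Matrix (Fin 3) (Fin 3) (mixedSpace L)) :=
    contDiff_iff_contDiffAt.2 fun x => Literature.Analysis.Calculus.contDiffAt_exp x
  have hAs : ContDiff ℝ ∞ A :=
    hψ'.contDiff_archExtZero.comp ((contDiff_snd.mul contDiff_const).mul (hexp.comp contDiff_fst))
  -- the bounded map `u ↦ ((u : GL₃)⁻¹ : M₃)` on the compact `supp φ`; the weight `φ` is integrable for `νinf` restricted to `supp φ`
  let m : UnitaryGroup.arch (↥(maximalRealSubfield L)) L (IsCMField.complexConj L) 3 H → Matrix (Fin 3) (Fin 3) (mixedSpace L) :=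
    fun u => (((u : GL (Fin 3) (mixedSpace L))⁻¹ : GL (Fin 3) (mixedSpace L)) : Matrix (Fin 3) (Fin 3) (mixedSpace L))
  obtain ⟨R, hR⟩ := (hφs.isCompact.image (Units.continuous_coe_inv.comp continuous_subtype_val :
    Continuous m)).isBounded.subset_closedBall (0 : Matrix (Fin 3) (Fin 3) (mixedSpace L))
  have hmR : ∀ᵐ u ∂(νinf.restrict (tsupport φ)), ‖m u‖ ≤ R := by
    refine (ae_restrict_iff' (isClosed_tsupport φ).measurableSet).2 (ae_of_all _ fun u hu => ?_)
    have h := hR ⟨u, hu, rfl⟩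
    rwa [Metric.mem_closedBall, dist_zero_right] at h
  have hF : Integrable φ (νinf.restrict (tsupport φ)) := (hφc.integrable_of_hasCompactSupport hφs).restrict
  -- (`M₃(L ⊗ ℝ)` with its product topology is pseudo-metrizable: read it on `Fin 3 → Fin 3 → L ⊗ ℝ`)
  haveI : TopologicalSpace.PseudoMetrizableSpace (Matrix (Fin 3) (Fin 3) (mixedSpace L)) :=
    inferInstanceAs (TopologicalSpace.PseudoMetrizableSpace (Fin 3 → Fin 3 → mixedSpace L))
  have hm : AEStronglyMeasurable m (νinf.restrict (tsupport φ)) :=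
    (Units.continuous_coe_inv.comp continuous_subtype_val).aestronglyMeasurable
  have hsmooth := Literature.Analysis.Calculus.contDiff_integral_kernel_mul hAs hm hmR hF
  -- identify with the exponential slice
  have hident : (fun M : Matrix (Fin 3) (Fin 3) (mixedSpace L) =>
      ∫ u, φ u * ψ' ((u⁻¹ : UnitaryGroup.arch (↥(maximalRealSubfield L)) L (IsCMField.complexConj L) 3 H) * (g' * expGL M)) ∂νinf) =
      fun M => ∫ u, A (M, m u) * φ u ∂(νinf.restrict (tsupport φ)) := by
    funext M
    rw [← setIntegral_eq_integral_of_forall_compl_eq_zero (s := tsupport φ) (fun u hu => by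
      rw [image_eq_zero_of_notMem_tsupport hu, zero_mul])]
    refine integral_congr_ae (ae_of_all _ fun u => ?_)
    show φ u * ψ' (((u⁻¹ : UnitaryGroup.arch (↥(maximalRealSubfield L)) L (IsCMField.complexConj L) 3 H) : GL (Fin 3) (mixedSpace L)) *
        (g' * expGL M)) = archExtZero ψ' (m u * (g' : Matrix (Fin 3) (Fin 3) (mixedSpace L)) * NormedSpace.exp M) * φ u
    rw [mul_comm (φ u), ← coe_expGL, ← Units.val_mul, ← Units.val_mul, archExtZero_coe, Subgroup.coe_inv, mul_assoc]
  rw [hident]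
  exact hsmooth

end Model

/-! ## §2 `ArchTestKc` is closed under convolution -/

/-- **`φ ⋆ ψ ∈ ArchTestKc` for `φ, ψ ∈ ArchTestKc`** (`(φ ⋆ ψ)(g) = ∫ φ(u) ψ(u⁻¹ g) dνinf(u)`, ★ `mulConv`, `νinf` a Haar measure on `G′_∞`): the smooth compactly supported
model on `GL₃(L ⊗ ℝ)` is `g' ↦ ∫ φ(u) ψ'(u⁻¹ g') dνinf(u)` (§1); right `K_c`-invariance from that of `ψ`; left `K_c`-invariance from that of `φ` after `u ↦ k u`
(left invariance of `νinf`).  This is the convolution conjunct of sub-goal (β)(a) `ArchTestKcPackage` of the T1 arch line, token for token under its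
`letI := borel _`. [cite: LabesseLanglands1979, Lemma 6.1 p. 768] [cite: Rogawski1990, §14.2 p. 233] -/
theorem ArchTestKc.mulConv (νinf : @Measure (UnitaryGroup.arch (↥(maximalRealSubfield L)) L (IsCMField.complexConj L) 3 H) (borel _))
    (hν : @Measure.IsHaarMeasure _ _ _ (borel _) νinf)
    {φ ψ : UnitaryGroup.arch (↥(maximalRealSubfield L)) L (IsCMField.complexConj L) 3 H → ℂ}
    (hφ : ArchTestKc L ι H T hT φ) (hψ : ArchTestKc L ι H T hT ψ) :
    ArchTestKc L ι H T hT (letI : MeasurableSpace (UnitaryGroup.arch (↥(maximalRealSubfield L)) L (IsCMField.complexConj L) 3 H) := borel _;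
      Literature.NumberTheory.Automorphic.mulConv νinf φ ψ) := by
  letI : MeasurableSpace (UnitaryGroup.arch (↥(maximalRealSubfield L)) L (IsCMField.complexConj L) 3 H) := borel _
  haveI : BorelSpace (UnitaryGroup.arch (↥(maximalRealSubfield L)) L (IsCMField.complexConj L) 3 H) := ⟨rfl⟩
  haveI := hν
  have hfin : IsFiniteMeasureOnCompacts νinf := inferInstance
  have hφc : Continuous φ := hφ.continuous
  have hφs : HasCompactSupport φ := hφ.hasCompactSupport
  rw [archTestKc_iff] at hφ hψ ⊢
  obtain ⟨⟨φ', hφ'c, hφ's, hφ'sm, hφφ'⟩, hφright, hφleft⟩ := hφ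
  obtain ⟨⟨ψ', hψ'c, hψ's, hψ'sm, hψψ'⟩, hψright, hψleft⟩ := hψ
  refine ⟨⟨fun g' => ∫ u, φ u * ψ' ((u⁻¹ : UnitaryGroup.arch (↥(maximalRealSubfield L)) L (IsCMField.complexConj L) 3 H) * g') ∂νinf,
      continuous_archConvModel νinf hφc hφs hψ'c hfin, hasCompactSupport_archConvModel νinf hφs hψ's,
      isArchSmooth_archConvModel νinf hφc hφs ⟨hψ'c, hψ's, hψ'sm⟩ hfin, fun k => ?_⟩, fun k hk a => ?_, fun k hk a => ?_⟩
  · -- the model restricts to `φ ⋆ ψ`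
    rw [mulConv_apply]
    refine integral_congr_ae (ae_of_all _ fun u => ?_)
    simp only [hψψ', Subgroup.coe_mul, Subgroup.coe_inv]
  · -- right `K_c`-invariance
    rw [mulConv_apply, mulConv_apply]
    refine integral_congr_ae (ae_of_all _ fun u => ?_)
    simp only [← mul_assoc, hψright k hk]
  · -- left `K_c`-invariance: substitute `u ↦ k_∞ u`
    rw [mulConv_apply, mulConv_apply,
      ← integral_mul_left_eq_self (fun u => φ u * ψ (u⁻¹ * (archPart (↥(maximalRealSubfield L)) L (IsCMField.complexConj L) 3 H k * a)))
        (archPart (↥(maximalRealSubfield L)) L (IsCMField.complexConj L) 3 H k)]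
    refine integral_congr_ae (ae_of_all _ fun u => ?_)
    simp only [mul_inv_rev, mul_assoc, inv_mul_cancel_left, hφleft k hk]

end Literature.NumberTheory.Rogawski1990

end
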